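import Literature.NumberTheory.BeurlingPrimes.WellBehavedSystemsCoupling
import Mathlib.MeasureTheory.Constructions.UnitInterval
import Mathlib.Probability.Independence.InfinitePi
import Mathlib.Probability.Moments.SubGaussian
import HarnessLib

/-!
# Broucke–Vindas 2024, Theorem 1.2 — III. The random model and the good sample point

Topic `Literature/NumberTheory/BeurlingPrimes`, grouping namespace `BrouckeVindas` (Broucke–Vindas 2024, §2,
proof of Theorem 1.2). Everything in this file is PROVED and definition-free.

BV §2: "Let `{P_j}` be a sequence of independent random variables … Fix a number `t ∈ ℝ` and set
`X_{j,t} = cos(t log P_j)` … Applying [Kolmogorov's exponential inequality, Lemma 2.1] to the random variables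
`X_{j,t} − E(X_{j,t})` … `P(|S(x,t) − S_c(x,t)| ≥ √2 D(√x + √(x log(|t|+1)/log(x+1)))) ≤ 4/((x+1)²(|t|+1)²)` …
the Borel–Cantelli lemma implies that the probability that infinitely many of the events `A_{k,j}` occur is
zero. Fix now a point `ω` of the probability space …".

Here the sample space is `[0,1]^ℕ` with the product of Lebesgue measures
(`Measure.infinitePi fun _ ↦ volume` on `ℕ → unitInterval`), the primes are `p_j = G(j + ω_j)` (quantile
coupling, parts I–II; `ω_j > 0` almost surely), and:
* `measureReal_sum_ge_le` — **Hoeffding's inequality** (Mathlib's `measure_sum_range_ge_le_of_iIndepFun` with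
  Hoeffding's lemma `hasSubgaussianMGF_of_mem_Icc`) for independent coordinate functions with values in
  `[−1, 1]`, used in place of BV's Lemma 2.1: `P(Σ_{j<n}(X_j − E X_j) ≥ ε) ≤ exp(−ε²/(2n))`;
* `measureReal_le_norm_dev_le` — four applications (`± Re`, `± Im`): `P(‖D_n(t)‖ ≥ 2v) ≤ 4 exp(−v²/(2n))`;
* `exists_good` — with levels `x_n = G(n)` (`n ≤ F(x_n) ≤ C₁ x_n/log(x_n + 1)`), the `t`-net `k/⌈x_n⌉`,
  thresholds `v = D₀(√x_n + √(n log(t+1)))`, `D₀² = 2C₁m`, each bad event has probability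
  `≤ 4((x_n+1)(t+1))^{−m}`; summing over the net (`Σ_{i≥N} i^{−2} ≤ 2/N`, `x_n ≥ n log 2/C₁`) the total is `≤ 1/2`
  for `m` large, so a union bound (instead of Borel–Cantelli: no exceptional events remain) yields a sample
  point `ω ∈ (0,1]^ℕ` that is good at every net point.

## References
* [BrouckeVindas2024] F. Broucke, J. Vindas, *A new generalized prime random approximation procedure and some of
  its applications*, Math. Z. 307 (2024), arXiv:2102.08478, §2, Lemma 2.1 and proof of Theorem 1.2 (read).
-/

noncomputable section

open Complex Filter MeasureTheory ProbabilityTheory Set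
open scoped Topology ENNReal NNReal

namespace Literature.NumberTheory.BeurlingPrimes

open Literature.Barriers.RiemannHypothesis

namespace BrouckeVindas

/-! ### The probability space `[0,1]^ℕ` -/

/-- The law of each coordinate of `[0,1]^ℕ` is Lebesgue measure on `[0,1]`. [folklore] -/
theorem infinitePi_map_eval_unitInterval (j : ℕ) :
    (Measure.infinitePi (fun _ : ℕ ↦ (volume : Measure unitInterval))).map (fun ω ↦ ω j) = volume :=
  Measure.infinitePi_map_eval _ j

/-- `P(∃ j, ω_j = 0) = 0`. [folklore] -/
theorem measure_exists_eq_zero :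
    Measure.infinitePi (fun _ : ℕ ↦ (volume : Measure unitInterval)) {ω | ∃ j, ω j = 0} = 0 := by
  rw [show {ω : ℕ → unitInterval | ∃ j, ω j = 0} = ⋃ j, {ω | ω j = 0} by ext; simp, measure_iUnion_null_iff]
  intro j
  have h := Measure.map_apply (μ := Measure.infinitePi (fun _ : ℕ ↦ (volume : Measure unitInterval)))
    (measurable_pi_apply j) (measurableSet_singleton (0 : unitInterval))
  rw [infinitePi_map_eval_unitInterval, measure_singleton] at h
  rw [show {ω : ℕ → unitInterval | ω j = 0} = (fun ω : ℕ → unitInterval ↦ ω j) ⁻¹' {0} from rfl, ← h]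

/-- Expectation of a function of one coordinate: `E g(ω_j) = ∫_{[0,1]} g`. [folklore] -/
theorem integral_comp_eval (j : ℕ) {g : ℝ → ℝ} (hg : Measurable g) :
    ∫ ω, g (ω j) ∂Measure.infinitePi (fun _ : ℕ ↦ (volume : Measure unitInterval)) = ∫ u in Icc (0 : ℝ) 1, g u := by
  have h := integral_map (μ := Measure.infinitePi (fun _ : ℕ ↦ (volume : Measure unitInterval)))
    (measurable_pi_apply j).aemeasurable (f := fun u : unitInterval ↦ g u)
    (hg.comp measurable_subtype_coe).aestronglyMeasurable
  rw [infinitePi_map_eval_unitInterval] at h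
  rw [← h]
  exact unitInterval.measurePreserving_coe.integral_comp unitInterval.measurableEmbedding_coe g

/-- Coordinate functions are independent. [cite: BrouckeVindas2024, §2 ("independent random variables")] -/
theorem iIndepFun_comp_eval {g : ℕ → ℝ → ℝ} (hg : ∀ j, Measurable (g j)) :
    iIndepFun (fun j (ω : ℕ → unitInterval) ↦ g j (ω j)) (Measure.infinitePi (fun _ : ℕ ↦ (volume : Measure unitInterval))) :=
  iIndepFun_infinitePi (P := fun _ : ℕ ↦ (volume : Measure unitInterval)) (X := fun j (u : unitInterval) ↦ g j u)
    fun j ↦ (hg j).comp measurable_subtype_coe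

/-- **Hoeffding's inequality on `[0,1]^ℕ`** (in place of BV Lemma 2.1): for independent coordinate functions
with values in `[−1, 1]`, `P(Σ_{j<n} (g_j(ω_j) − E g_j) ≥ ε) ≤ exp(−ε²/(2n))`. [cite: BrouckeVindas2024, Lemma 2.1] -/
theorem measureReal_sum_ge_le {g : ℕ → ℝ → ℝ} (hg : ∀ j, Measurable (g j))
    (hb : ∀ j u, g j u ∈ Icc (-1 : ℝ) 1) (n : ℕ) {ε : ℝ} (hε : 0 ≤ ε) :
    (Measure.infinitePi (fun _ : ℕ ↦ (volume : Measure unitInterval))).real {ω | ε ≤ ∑ j ∈ Finset.range n,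
      (g j (ω j) - ∫ ω', g j (ω' j) ∂Measure.infinitePi (fun _ : ℕ ↦ (volume : Measure unitInterval)))} ≤
      Real.exp (-ε ^ 2 / (2 * n)) := by
  set μ := Measure.infinitePi (fun _ : ℕ ↦ (volume : Measure unitInterval)) with hμ
  have hind : iIndepFun (fun j (ω : ℕ → unitInterval) ↦ g j (ω j) - ∫ ω', g j (ω' j) ∂μ) μ :=
    iIndepFun_comp_eval (g := fun j u ↦ g j u - ∫ ω', g j (ω' j) ∂μ) fun j ↦ (hg j).sub_const _
  have hc : ((‖(1 : ℝ) - (-1)‖₊ / 2) ^ 2 : ℝ≥0) = 1 := by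
    apply NNReal.eq
    push_cast
    rw [show (1 : ℝ) - (-1) = 2 by norm_num, Real.norm_eq_abs, abs_of_pos two_pos]
    norm_num
  have hsub : ∀ i < n, HasSubgaussianMGF (fun ω : ℕ → unitInterval ↦ g i (ω i) - ∫ ω', g i (ω' i) ∂μ) 1 μ := by
    intro i _
    have h := hasSubgaussianMGF_of_mem_Icc (μ := μ) (X := fun ω : ℕ → unitInterval ↦ g i (ω i)) (a := -1) (b := 1)
      ((hg i).comp (measurable_subtype_coe.comp (measurable_pi_apply i))).aemeasurable
      (Eventually.of_forall fun ω ↦ hb i (ω i))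
    rwa [hc] at h
  have h := HasSubgaussianMGF.measure_sum_range_ge_le_of_iIndepFun hind hsub hε
  simpa using h

/-! ### The deviation as a sum of independent centred terms -/

variable {F : StieltjesFunction ℝ} {G : ℝ → ℝ} {D : (ℕ → ℝ) → ℕ → ℝ → ℂ}
variable (h1 : F 1 = 0) (hG : ∀ ⦃s : ℝ⦄, 0 < s → ∀ y : ℝ, G s ≤ y ↔ s ≤ F y) (hGm : Monotone G)
  (hG1 : ∀ s, 1 ≤ G s)
variable (hD : ∀ (ω : ℕ → ℝ) (n : ℕ) (t : ℝ), D ω n t =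
  ∑ j ∈ Finset.range n, ((G (j + ω j) : ℂ)) ^ (-(t * I)) - ∫ s in Ioc (0 : ℝ) n, ((G s : ℂ)) ^ (-(t * I)))

include hGm hG1 hD in
/-- `D(ω,n,t) = Σ_{j<n} (G(j+ω_j)^{−it} − ∫_{[0,1]} G(j+u)^{−it} du)`. [cite: BrouckeVindas2024, §2] -/
theorem dev_eq_sum_sub (ω : ℕ → ℝ) (n : ℕ) (t : ℝ) :
    D ω n t = ∑ j ∈ Finset.range n,
      (((G (j + ω j) : ℂ)) ^ (-(t * I)) - ∫ u in Icc (0 : ℝ) 1, ((G (j + u) : ℂ)) ^ (-(t * I))) := by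
  rw [hD, ← sum_integral_cpow_comp hGm hG1 t n, Finset.sum_sub_distrib]
  congr 1
  refine Finset.sum_congr rfl fun j _ ↦ ?_
  exact integral_Icc_eq_integral_Ioc.symm

include hGm hG1 hD in
/-- `Re D(ω,n,t) = Σ_{j<n} (X_j − E X_j)` with `X_j = Re G(j+ω_j)^{−it} = cos(t log P_j)`.
[cite: BrouckeVindas2024, §2 ("X_{j,t} = cos(t log P_j)")] -/
theorem re_dev (ω : ℕ → unitInterval) (n : ℕ) (t : ℝ) :
    (D (fun j ↦ (ω j : ℝ)) n t).re = ∑ j ∈ Finset.range n, ((((G (j + (ω j : ℝ)) : ℂ)) ^ (-(t * I))).re -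
      ∫ ω' : ℕ → unitInterval, (((G (j + (ω' j : ℝ)) : ℂ)) ^ (-(t * I))).re
        ∂Measure.infinitePi (fun _ : ℕ ↦ (volume : Measure unitInterval))) := by
  rw [dev_eq_sum_sub hGm hG1 hD, re_sum]
  refine Finset.sum_congr rfl fun j _ ↦ ?_
  rw [sub_re, integral_comp_eval j (g := fun u ↦ (((G (j + u) : ℂ)) ^ (-(t * I))).re)
    (measurable_re.comp (((measurable_cpow_negI t).comp hGm.measurable).comp (measurable_const_add (j : ℝ))))]
  have h := integral_re ((integrableOn_cpow_comp_add hGm hG1 (j : ℝ) t (A := Icc (0 : ℝ) 1) (by simp)).integrable)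
  simp only [RCLike.re_to_complex] at h
  rw [h]

include hGm hG1 hD in
/-- `Im D(ω,n,t) = Σ_{j<n} (Y_j − E Y_j)` with `Y_j = Im G(j+ω_j)^{−it} = −sin(t log P_j)`.
[cite: BrouckeVindas2024, §2 ("±Y_{j,t} = ±sin(t log P_j)")] -/
theorem im_dev (ω : ℕ → unitInterval) (n : ℕ) (t : ℝ) :
    (D (fun j ↦ (ω j : ℝ)) n t).im = ∑ j ∈ Finset.range n, ((((G (j + (ω j : ℝ)) : ℂ)) ^ (-(t * I))).im -
      ∫ ω' : ℕ → unitInterval, (((G (j + (ω' j : ℝ)) : ℂ)) ^ (-(t * I))).im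
        ∂Measure.infinitePi (fun _ : ℕ ↦ (volume : Measure unitInterval))) := by
  rw [dev_eq_sum_sub hGm hG1 hD, im_sum]
  refine Finset.sum_congr rfl fun j _ ↦ ?_
  rw [sub_im, integral_comp_eval j (g := fun u ↦ (((G (j + u) : ℂ)) ^ (-(t * I))).im)
    (measurable_im.comp (((measurable_cpow_negI t).comp hGm.measurable).comp (measurable_const_add (j : ℝ))))]
  have h := integral_im ((integrableOn_cpow_comp_add hGm hG1 (j : ℝ) t (A := Icc (0 : ℝ) 1) (by simp)).integrable)
  simp only [RCLike.im_to_complex] at h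
  rw [h]

/-- Negating a centred coordinate sum. [folklore] -/
theorem neg_sum_sub_integral (g : ℕ → ℝ → ℝ) (ω : ℕ → unitInterval) (n : ℕ) :
    -∑ j ∈ Finset.range n, (g j (ω j) - ∫ ω' : ℕ → unitInterval, g j (ω' j)
        ∂Measure.infinitePi (fun _ : ℕ ↦ (volume : Measure unitInterval))) =
      ∑ j ∈ Finset.range n, (-g j (ω j) - ∫ ω' : ℕ → unitInterval, -g j (ω' j)
        ∂Measure.infinitePi (fun _ : ℕ ↦ (volume : Measure unitInterval))) := by
  rw [← Finset.sum_neg_distrib]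
  refine Finset.sum_congr rfl fun j _ ↦ ?_
  rw [integral_neg]
  ring

include hGm hG1 hD in
/-- **Concentration of `D(ω,n,t)`** (BV: "Applying the same argument to the random variables `−X_{j,t}`,
`±Y_{j,t}` … we get the same bounds"): `P(‖D(ω,n,t)‖ ≥ 2v) ≤ 4 exp(−v²/(2n))` for `v ≥ 0`.
[cite: BrouckeVindas2024, §2 (proof of Theorem 1.2)] -/
theorem measureReal_le_norm_dev_le (n : ℕ) (t : ℝ) {v : ℝ} (hv : 0 ≤ v) :
    (Measure.infinitePi (fun _ : ℕ ↦ (volume : Measure unitInterval))).real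
      {ω | 2 * v ≤ ‖D (fun j ↦ (ω j : ℝ)) n t‖} ≤ 4 * Real.exp (-v ^ 2 / (2 * n)) := by
  set μ := Measure.infinitePi (fun _ : ℕ ↦ (volume : Measure unitInterval)) with hμ
  set gr : ℕ → ℝ → ℝ := fun j u ↦ (((G (j + u) : ℂ)) ^ (-(t * I))).re with hgr_def
  set gi : ℕ → ℝ → ℝ := fun j u ↦ (((G (j + u) : ℂ)) ^ (-(t * I))).im with hgi_def
  have hmeas : ∀ j : ℕ, Measurable fun u : ℝ ↦ ((G (j + u) : ℂ)) ^ (-(t * I)) := fun j ↦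
    ((measurable_cpow_negI t).comp hGm.measurable).comp (measurable_const_add (j : ℝ))
  have hmr : ∀ j, Measurable (gr j) := fun j ↦ measurable_re.comp (hmeas j)
  have hmi : ∀ j, Measurable (gi j) := fun j ↦ measurable_im.comp (hmeas j)
  have hpos : ∀ s, 0 < G s := fun s ↦ one_pos.trans_le (hG1 s)
  have hbr : ∀ j u, gr j u ∈ Icc (-1 : ℝ) 1 := fun j u ↦ abs_le.1 (abs_re_cpow_negI_le (hpos _) t)
  have hbi : ∀ j u, gi j u ∈ Icc (-1 : ℝ) 1 := fun j u ↦ abs_le.1 (abs_im_cpow_negI_le (hpos _) t)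
  have hbr' : ∀ j u, -gr j u ∈ Icc (-1 : ℝ) 1 := fun j u ↦ by
    have := hbr j u; simp only [mem_Icc] at this ⊢; constructor <;> linarith
  have hbi' : ∀ j u, -gi j u ∈ Icc (-1 : ℝ) 1 := fun j u ↦ by
    have := hbi j u; simp only [mem_Icc] at this ⊢; constructor <;> linarith
  -- the four one-sided events
  set E : (ℕ → ℝ → ℝ) → Set (ℕ → unitInterval) := fun g ↦
    {ω | v ≤ ∑ j ∈ Finset.range n, (g j (ω j) - ∫ ω' : ℕ → unitInterval, g j (ω' j) ∂μ)} with hE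
  have hsub : {ω : ℕ → unitInterval | 2 * v ≤ ‖D (fun j ↦ (ω j : ℝ)) n t‖} ⊆
      ((E gr ∪ E (fun j u ↦ -gr j u)) ∪ E gi) ∪ E (fun j u ↦ -gi j u) := by
    intro ω hω
    simp only [mem_setOf_eq] at hω
    by_contra hcon
    simp only [hE, mem_union, mem_setOf_eq, not_or, not_le] at hcon
    obtain ⟨⟨⟨h₁, h₂⟩, h₃⟩, h₄⟩ := hcon
    have hre := re_dev hGm hG1 hD ω n t
    have him := im_dev hGm hG1 hD ω n t
    rw [← neg_sum_sub_integral] at h₂ h₄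
    rw [← hre] at h₁ h₂
    rw [← him] at h₃ h₄
    have habs : |(D (fun j ↦ (ω j : ℝ)) n t).re| + |(D (fun j ↦ (ω j : ℝ)) n t).im| < 2 * v := by
      have := abs_lt.2 ⟨by linarith, h₁⟩
      have := abs_lt.2 ⟨by linarith, h₃⟩
      linarith
    linarith [norm_le_abs_re_add_abs_im (D (fun j ↦ (ω j : ℝ)) n t)]
  have hE1 := measureReal_sum_ge_le hmr hbr n hv
  have hE2 := measureReal_sum_ge_le (g := fun j u ↦ -gr j u) (fun j ↦ (hmr j).neg) hbr' n hv
  have hE3 := measureReal_sum_ge_le hmi hbi n hv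
  have hE4 := measureReal_sum_ge_le (g := fun j u ↦ -gi j u) (fun j ↦ (hmi j).neg) hbi' n hv
  have u0 := measureReal_mono hsub (μ := μ)
  have u1 := measureReal_union_le (μ := μ) ((E gr ∪ E (fun j u ↦ -gr j u)) ∪ E gi) (E (fun j u ↦ -gi j u))
  have u2 := measureReal_union_le (μ := μ) (E gr ∪ E (fun j u ↦ -gr j u)) (E gi)
  have u3 := measureReal_union_le (μ := μ) (E gr) (E (fun j u ↦ -gr j u))
  simp only [hE] at hE1 hE2 hE3 hE4 u0 u1 u2 u3 ⊢
  linarith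

/-! ### The exponent and the two summations -/

/-- **The exponent** (BV: "Hence the above probability is bounded by `(x+1)^{−2}(|t|+1)^{−2}`"): if
`1 ≤ C₁`, `1 ≤ n ≤ C₁ x/log(x+1)`, `x ≥ 1`, `t ≥ 0` and `v = √(2C₁m)(√x + √(n log(t+1)))`, then
`exp(−v²/(2n)) ≤ ((x+1)(t+1))^{−m}`. [cite: BrouckeVindas2024, §2 (proof of Theorem 1.2)] -/
theorem exp_neg_sq_le {C₁ x t : ℝ} {n m : ℕ} (hC₁ : 1 ≤ C₁) (hn : 1 ≤ n) (hx : 1 ≤ x) (ht : 0 ≤ t)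
    (hcheb : (n : ℝ) ≤ C₁ * x / Real.log (x + 1)) :
    Real.exp (-(Real.sqrt (2 * C₁ * m) * (Real.sqrt x + Real.sqrt (n * Real.log (t + 1)))) ^ 2 / (2 * n)) ≤
      (((x + 1) * (t + 1)) ^ m)⁻¹ := by
  have hP : 0 < (x + 1) * (t + 1) := by positivity
  have hlx : 0 < Real.log (x + 1) := Real.log_pos (by linarith)
  have hlt : 0 ≤ Real.log (t + 1) := Real.log_nonneg (by linarith)
  have hn0 : (0 : ℝ) < n := by exact_mod_cast hn
  have hm0 : (0 : ℝ) ≤ m := Nat.cast_nonneg m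
  rw [← Real.exp_log (pow_pos hP m), ← Real.exp_neg, Real.exp_le_exp, Real.log_pow, Real.log_mul (by positivity)
    (by positivity), neg_div, neg_le_neg_iff]
  rw [le_div_iff₀ (by positivity)]
  have hsq : (Real.sqrt (2 * C₁ * m) * (Real.sqrt x + Real.sqrt (n * Real.log (t + 1)))) ^ 2 ≥
      2 * C₁ * m * (x + n * Real.log (t + 1)) := by
    rw [mul_pow, Real.sq_sqrt (by positivity)]
    refine mul_le_mul_of_nonneg_left ?_ (by positivity)
    have h2 : (Real.sqrt x + Real.sqrt (n * Real.log (t + 1))) ^ 2 =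
        x + n * Real.log (t + 1) + 2 * (Real.sqrt x * Real.sqrt (n * Real.log (t + 1))) := by
      rw [add_sq, Real.sq_sqrt (by positivity), Real.sq_sqrt (by positivity)]; ring
    rw [h2]
    linarith [mul_nonneg (Real.sqrt_nonneg x) (Real.sqrt_nonneg (n * Real.log (t + 1)))]
  have hnx : (n : ℝ) * Real.log (x + 1) ≤ C₁ * x := by
    rwa [le_div_iff₀ hlx] at hcheb
  have h3 : (m : ℝ) * Real.log (x + 1) * (2 * n) ≤ 2 * C₁ * m * x := by nlinarith
  have h4 : (m : ℝ) * Real.log (t + 1) * (2 * n) ≤ 2 * C₁ * m * (n * Real.log (t + 1)) := by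
    have : (m : ℝ) * Real.log (t + 1) * n * 1 ≤ m * Real.log (t + 1) * n * C₁ :=
      mul_le_mul_of_nonneg_left hC₁ (by positivity)
    nlinarith
  nlinarith

/-- `Σ_{k<K} 1/(k+N)² ≤ 2/N` for `N ≥ 1` (telescoping with `1/(k+N)² ≤ 2/((k+N)(k+N+1))`). [folklore] -/
theorem sum_inv_add_sq_le {N : ℕ} (hN : 1 ≤ N) (K : ℕ) :
    ∑ k ∈ Finset.range K, (((k : ℝ) + N) ^ 2)⁻¹ ≤ 2 / N := by
  have hN0 : (0 : ℝ) < N := by exact_mod_cast hN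
  have hterm : ∀ k ∈ Finset.range K,
      (((k : ℝ) + N) ^ 2)⁻¹ ≤ 2 * ((((k : ℕ) : ℝ) + N)⁻¹ - ((((k + 1 : ℕ) : ℝ)) + N)⁻¹) := by
    intro k _
    have hk : (0 : ℝ) < k + N := by positivity
    have hk1 : (1 : ℝ) ≤ k + N := by
      have : (1 : ℝ) ≤ N := by exact_mod_cast hN
      linarith [Nat.cast_nonneg (α := ℝ) k]
    have e : 2 * ((((k : ℕ) : ℝ) + N)⁻¹ - ((((k + 1 : ℕ) : ℝ)) + N)⁻¹) = 2 / ((k + N) * (k + N + 1)) := by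
      rw [show (((k + 1 : ℕ) : ℝ)) + N = (k + N) + 1 by push_cast; ring]
      field_simp
      ring
    rw [e, inv_eq_one_div, div_le_div_iff₀ (by positivity) (by positivity)]
    nlinarith
  refine (Finset.sum_le_sum hterm).trans ?_
  rw [← Finset.mul_sum, Finset.sum_range_sub' (fun k : ℕ ↦ ((k : ℝ) + N)⁻¹) K]
  simp only [Nat.cast_zero, zero_add]
  have : (0 : ℝ) ≤ ((K : ℝ) + N)⁻¹ := by positivity
  rw [div_eq_mul_inv]
  linarith

/-! ### The good sample point -/

include h1 hG hG1 in
/-- **Lower bound for the levels**: `n log 2/C₁ ≤ G(n)` for `n ≥ 1` (from `n ≤ F(G(n)) ≤ C₁ G(n)/log(G(n)+1)`).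
[cite: BrouckeVindas2024, §2 ("Σ 4/((q_j+1)²(|k|+1)²) ≪ Σ 1/(j²k²)")] -/
theorem level_ge {C₁ : ℝ} (hC₁ : 1 ≤ C₁) (hcheb : ∀ x, 1 ≤ x → F x ≤ C₁ * x / Real.log (x + 1))
    {n : ℕ} (hn : 1 ≤ n) : Real.log 2 / C₁ * n ≤ G n := by
  have hn0 : (0 : ℝ) < n := by exact_mod_cast hn
  set x := G n with hx
  have hx1 : 1 ≤ x := hG1 n
  have hFx : (n : ℝ) ≤ F x := le_apply_of_galois hG hn0
  have hch := hcheb x hx1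
  have hl2 : Real.log 2 ≤ Real.log (x + 1) := Real.log_le_log two_pos (by linarith)
  have hl2' : 0 < Real.log 2 := Real.log_pos one_lt_two
  have h3 : C₁ * x / Real.log (x + 1) ≤ C₁ * x / Real.log 2 :=
    div_le_div_of_nonneg_left (by nlinarith) hl2' hl2
  have h4 : (n : ℝ) ≤ C₁ * x / Real.log 2 := hFx.trans (hch.trans h3)
  rw [le_div_iff₀ hl2'] at h4
  rw [div_mul_eq_mul_div, div_le_iff₀ (by linarith)]
  have := h1
  linarith

include hG hG1 in
/-- `n ≤ C₁ G(n)/log(G(n)+1)` for `n ≥ 1`. [cite: BrouckeVindas2024, §2 ("σ² ≤ J = F_c(x) ≤ C x/log(x+1)")] -/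
theorem level_cheb {C₁ : ℝ} (hcheb : ∀ x, 1 ≤ x → F x ≤ C₁ * x / Real.log (x + 1)) {n : ℕ} (hn : 1 ≤ n) :
    (n : ℝ) ≤ C₁ * G n / Real.log (G n + 1) :=
  (le_apply_of_galois hG (by exact_mod_cast hn)).trans (hcheb _ (hG1 n))

include hG hGm hG1 hD in
/-- **The probability of one bad event**: for `n ≥ 1`, `x = G(n)`, `N = ⌈x⌉`, `t = k/N` and
`v = √(2C₁m)(√x + √(n log(t+1)))`, `P(‖D(ω,n,t)‖ ≥ 2v) ≤ 4N²/((x+1)^m (k+N)²)`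
(`≤ 4((x+1)(t+1))^{−m}`, relaxed using `m ≥ 2`). [cite: BrouckeVindas2024, §2 (proof of Theorem 1.2)] -/
theorem measureReal_bad_le {C₁ : ℝ} (hC₁ : 1 ≤ C₁) (hcheb : ∀ x, 1 ≤ x → F x ≤ C₁ * x / Real.log (x + 1))
    {m : ℕ} (hm : 2 ≤ m) {n : ℕ} (hn : 1 ≤ n) (k : ℕ) :
    (Measure.infinitePi (fun _ : ℕ ↦ (volume : Measure unitInterval))).real
      {ω | 2 * (Real.sqrt (2 * C₁ * m) * (Real.sqrt (G n) + Real.sqrt (n * Real.log (k / ⌈G n⌉₊ + 1)))) ≤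
          ‖D (fun j ↦ (ω j : ℝ)) n (k / ⌈G n⌉₊)‖} ≤
      4 * (⌈G n⌉₊ : ℝ) ^ 2 / ((G n + 1) ^ m * ((k : ℝ) + ⌈G n⌉₊) ^ 2) := by
  set x := G n with hx
  set N := ⌈x⌉₊ with hN
  have hx1 : 1 ≤ x := hG1 n
  have hN1 : 1 ≤ N := Nat.ceil_pos.2 (by linarith)
  have hN0 : (0 : ℝ) < N := by exact_mod_cast hN1
  have ht : (0 : ℝ) ≤ k / N := by positivity
  have hstep1 := measureReal_le_norm_dev_le hGm hG1 hD n ((k : ℝ) / N)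
    (v := Real.sqrt (2 * C₁ * m) * (Real.sqrt x + Real.sqrt (n * Real.log (k / N + 1)))) (by positivity)
  have hstep2 := exp_neg_sq_le (m := m) hC₁ hn hx1 ht (level_cheb hG hG1 hcheb hn)
  refine hstep1.trans ((mul_le_mul_of_nonneg_left hstep2 (by norm_num)).trans ?_)
  have hkN : (k : ℝ) / N + 1 = ((k : ℝ) + N) / N := by field_simp
  have hbase : 1 ≤ (k : ℝ) / N + 1 := by linarith
  have hpow : ((k : ℝ) / N + 1) ^ 2 ≤ ((k : ℝ) / N + 1) ^ m := pow_le_pow_right₀ hbase hm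
  have hxm : 0 < (x + 1) ^ m := by positivity
  have key : (((x + 1) * ((k : ℝ) / N + 1)) ^ m)⁻¹ ≤ (N : ℝ) ^ 2 / ((x + 1) ^ m * ((k : ℝ) + N) ^ 2) := by
    rw [mul_pow]
    calc ((x + 1) ^ m * ((k : ℝ) / N + 1) ^ m)⁻¹
        ≤ ((x + 1) ^ m * ((k : ℝ) / N + 1) ^ 2)⁻¹ := by gcongr
      _ = (N : ℝ) ^ 2 / ((x + 1) ^ m * ((k : ℝ) + N) ^ 2) := by
          rw [hkN, div_pow]
          field_simp
  calc 4 * (((x + 1) * ((k : ℝ) / N + 1)) ^ m)⁻¹ ≤ 4 * ((N : ℝ) ^ 2 / ((x + 1) ^ m * ((k : ℝ) + N) ^ 2)) := by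
        gcongr
    _ = _ := by ring

include h1 hG hGm hG1 hD in
/-- **Existence of a good sample point** (BV: Borel–Cantelli and "Fix now a point `ω` … then there exists
`k₀` …"; here a union bound with total mass `≤ 1/2`, so no exceptional events remain): there are `D₀ ≥ 0` and
`ω ∈ (0,1]^ℕ` such that for every level `n ≥ 1` and every net point `t = k/⌈G(n)⌉`,
`‖D(ω,n,t)‖ < 2D₀(√G(n) + √(n log(t+1)))`. [cite: BrouckeVindas2024, §2 (proof of Theorem 1.2)] -/
theorem exists_good {C₁ : ℝ} (hC₁ : 1 ≤ C₁) (hcheb : ∀ x, 1 ≤ x → F x ≤ C₁ * x / Real.log (x + 1)) :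
    ∃ D₀ : ℝ, 0 ≤ D₀ ∧ ∃ ω : ℕ → ℝ, (∀ j, ω j ∈ Ioc (0 : ℝ) 1) ∧
      ∀ n : ℕ, 1 ≤ n → ∀ k : ℕ,
        ‖D ω n (k / ⌈G n⌉₊)‖ < 2 * (D₀ * (Real.sqrt (G n) + Real.sqrt (n * Real.log (k / ⌈G n⌉₊ + 1)))) := by
  set μ := Measure.infinitePi (fun _ : ℕ ↦ (volume : Measure unitInterval)) with hμ
  -- constants
  set a : ℝ := Real.log 2 / C₁ with ha_def
  have hC0 : 0 < C₁ := by linarith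
  have ha : 0 < a := div_pos (Real.log_pos one_lt_two) hC0
  obtain ⟨m', hm'⟩ := pow_unbounded_of_one_lt (32 / a ^ 2) (by linarith : (1 : ℝ) < 1 + a)
  set m : ℕ := m' + 3 with hm_def
  have hm2 : 2 ≤ m := by omega
  set D₀ : ℝ := Real.sqrt (2 * C₁ * m) with hD₀
  refine ⟨D₀, Real.sqrt_nonneg _, ?_⟩
  -- the bad events, indexed by `(n, k)` for the level `n + 1`
  set A : ℕ → ℕ → Set (ℕ → unitInterval) := fun n k ↦
    {ω | 2 * (D₀ * (Real.sqrt (G (n + 1 : ℕ)) +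
      Real.sqrt ((n + 1 : ℕ) * Real.log (k / ⌈G (n + 1 : ℕ)⌉₊ + 1)))) ≤
        ‖D (fun j ↦ (ω j : ℝ)) (n + 1) (k / ⌈G (n + 1 : ℕ)⌉₊)‖} with hA
  -- (1) one event
  have hone : ∀ n k : ℕ, μ (A n k) ≤ ENNReal.ofReal
      (4 * (⌈G (n + 1 : ℕ)⌉₊ : ℝ) ^ 2 / ((G (n + 1 : ℕ) + 1) ^ m * ((k : ℝ) + ⌈G (n + 1 : ℕ)⌉₊) ^ 2)) := by
    intro n k
    rw [← ofReal_measureReal]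
    refine ENNReal.ofReal_le_ofReal ?_
    exact measureReal_bad_le hG hGm hG1 hD hC₁ hcheb hm2 (n := n + 1) (by omega) k
  -- (2) the sum over `k` at level `n + 1`
  have hinner : ∀ n : ℕ, ∑' k, μ (A n k) ≤ ENNReal.ofReal (8 / (G (n + 1 : ℕ) + 1) ^ (m' + 2)) := by
    intro n
    set x := G (n + 1 : ℕ) with hx
    set N := ⌈x⌉₊ with hN
    have hx1 : 1 ≤ x := hG1 _
    have hN1 : 1 ≤ N := Nat.ceil_pos.2 (by linarith)
    have hN0 : (0 : ℝ) < N := by exact_mod_cast hN1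
    have hNx : (N : ℝ) ≤ x + 1 := (Nat.ceil_lt_add_one (by linarith)).le
    refine ENNReal.tsum_le_of_sum_range_le fun K ↦ ?_
    calc ∑ k ∈ Finset.range K, μ (A n k)
        ≤ ∑ k ∈ Finset.range K, ENNReal.ofReal (4 * (N : ℝ) ^ 2 / ((x + 1) ^ m * ((k : ℝ) + N) ^ 2)) :=
          Finset.sum_le_sum fun k _ ↦ hone n k
      _ = ENNReal.ofReal (∑ k ∈ Finset.range K, 4 * (N : ℝ) ^ 2 / ((x + 1) ^ m * ((k : ℝ) + N) ^ 2)) :=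
          (ENNReal.ofReal_sum_of_nonneg fun k _ ↦ by positivity).symm
      _ ≤ ENNReal.ofReal (8 / (x + 1) ^ (m' + 2)) := by
          refine ENNReal.ofReal_le_ofReal ?_
          have hsum := sum_inv_add_sq_le hN1 K
          have hrw : ∑ k ∈ Finset.range K, 4 * (N : ℝ) ^ 2 / ((x + 1) ^ m * ((k : ℝ) + N) ^ 2) =
              4 * (N : ℝ) ^ 2 / (x + 1) ^ m * ∑ k ∈ Finset.range K, (((k : ℝ) + N) ^ 2)⁻¹ := by
            rw [Finset.mul_sum]
            refine Finset.sum_congr rfl fun k _ ↦ ?_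
            field_simp
          rw [hrw]
          have hxm : 0 < (x + 1) ^ m := by positivity
          calc 4 * (N : ℝ) ^ 2 / (x + 1) ^ m * ∑ k ∈ Finset.range K, (((k : ℝ) + N) ^ 2)⁻¹
              ≤ 4 * (N : ℝ) ^ 2 / (x + 1) ^ m * (2 / N) :=
                mul_le_mul_of_nonneg_left hsum (by positivity)
            _ = 8 * N / (x + 1) ^ m := by
                field_simp
                norm_num
            _ ≤ 8 * (x + 1) / (x + 1) ^ m := by gcongr
            _ = 8 / (x + 1) ^ (m' + 2) := by
                rw [hm_def, show m' + 3 = (m' + 2) + 1 by ring, pow_succ]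
                field_simp
  -- (3) the sum over the levels
  have houter : ∑' n, ∑' k, μ (A n k) ≤ ENNReal.ofReal (1 / 2) := by
    refine ENNReal.tsum_le_of_sum_range_le fun M ↦ ?_
    calc ∑ n ∈ Finset.range M, ∑' k, μ (A n k)
        ≤ ∑ n ∈ Finset.range M, ENNReal.ofReal (8 / (G (n + 1 : ℕ) + 1) ^ (m' + 2)) :=
          Finset.sum_le_sum fun n _ ↦ hinner n
      _ = ENNReal.ofReal (∑ n ∈ Finset.range M, 8 / (G (n + 1 : ℕ) + 1) ^ (m' + 2)) :=
          (ENNReal.ofReal_sum_of_nonneg fun n _ ↦ by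
            have := hG1 ((n + 1 : ℕ) : ℝ); positivity).symm
      _ ≤ ENNReal.ofReal (1 / 2) := by
          refine ENNReal.ofReal_le_ofReal ?_
          have hterm : ∀ n ∈ Finset.range M, 8 / (G (n + 1 : ℕ) + 1) ^ (m' + 2) ≤
              8 / (a ^ 2 * (1 + a) ^ m') * ((((n : ℝ) + 1)) ^ 2)⁻¹ := by
            intro n _
            have hlev := level_ge h1 hG hG1 hC₁ hcheb (n := n + 1) (by omega)
            rw [← ha_def] at hlev
            set x := G (n + 1 : ℕ)
            have hn1 : (1 : ℝ) ≤ (n + 1 : ℕ) := by exact_mod_cast Nat.succ_pos n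
            have hax : a * (n + 1 : ℕ) ≤ x := hlev
            have h1a : 1 + a ≤ x + 1 := by nlinarith
            have hpow1 : (1 + a) ^ m' ≤ (x + 1) ^ m' := pow_le_pow_left₀ (by linarith) h1a m'
            have hsq : (a * ((n : ℝ) + 1)) ^ 2 ≤ (x + 1) ^ 2 := by
              refine pow_le_pow_left₀ (by positivity) ?_ 2
              push_cast at hax; linarith
            have hprod : a ^ 2 * (1 + a) ^ m' * ((n : ℝ) + 1) ^ 2 ≤ (x + 1) ^ (m' + 2) := by
              rw [pow_add, mul_comm ((x + 1) ^ m')]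
              calc a ^ 2 * (1 + a) ^ m' * ((n : ℝ) + 1) ^ 2 = (a * ((n : ℝ) + 1)) ^ 2 * (1 + a) ^ m' := by ring
                _ ≤ (x + 1) ^ 2 * (x + 1) ^ m' :=
                    mul_le_mul hsq hpow1 (by positivity) (by positivity)
            rw [← div_eq_mul_inv, div_div]
            exact div_le_div_of_nonneg_left (by norm_num) (by positivity) hprod
          refine (Finset.sum_le_sum hterm).trans ?_
          rw [← Finset.mul_sum]
          have hs := sum_inv_add_sq_le (le_refl 1) M
          simp only [Nat.cast_one] at hs
          have h32 : 32 < a ^ 2 * (1 + a) ^ m' := by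
            rwa [div_lt_iff₀ (by positivity), mul_comm] at hm'
          have hpos : 0 < a ^ 2 * (1 + a) ^ m' := by positivity
          calc 8 / (a ^ 2 * (1 + a) ^ m') * ∑ n ∈ Finset.range M, (((n : ℝ) + 1) ^ 2)⁻¹
              ≤ 8 / (a ^ 2 * (1 + a) ^ m') * (2 / 1) := mul_le_mul_of_nonneg_left hs (by positivity)
            _ = 16 / (a ^ 2 * (1 + a) ^ m') := by ring
            _ ≤ 1 / 2 := by
                rw [div_le_div_iff₀ hpos two_pos]; linarith
  -- (4) the union bound
  set U : Set (ℕ → unitInterval) := {ω | ∃ j, ω j = 0} ∪ ⋃ n, ⋃ k, A n k with hU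
  have hUlt : μ U < 1 := by
    calc μ U ≤ μ {ω | ∃ j, ω j = 0} + μ (⋃ n, ⋃ k, A n k) := measure_union_le _ _
      _ ≤ 0 + ∑' n, ∑' k, μ (A n k) := by
          refine add_le_add measure_exists_eq_zero.le ?_
          exact (measure_iUnion_le _).trans (ENNReal.tsum_le_tsum fun n ↦ measure_iUnion_le _)
      _ ≤ ENNReal.ofReal (1 / 2) := by rw [zero_add]; exact houter
      _ < 1 := by rw [ENNReal.ofReal_lt_one]; norm_num
  have hUne : U ≠ univ := fun h ↦ by
    rw [h, measure_univ] at hUlt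
    exact lt_irrefl _ hUlt
  obtain ⟨ω, hω⟩ := nonempty_compl.2 hUne
  simp only [hU, mem_compl_iff, mem_union, mem_iUnion, mem_setOf_eq, not_or, not_exists] at hω
  obtain ⟨hω0, hωA⟩ := hω
  refine ⟨fun j ↦ (ω j : ℝ), fun j ↦ ⟨?_, (ω j).2.2⟩, fun n hn k ↦ ?_⟩
  · have hne : (ω j : ℝ) ≠ 0 := fun h ↦ hω0 j (Subtype.ext h)
    exact lt_of_le_of_ne (ω j).2.1 (Ne.symm hne)
  · obtain ⟨n', rfl⟩ : ∃ n', n = n' + 1 := ⟨n - 1, by omega⟩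
    have h := hωA n' k
    simp only [hA, mem_setOf_eq, not_le] at h
    exact h

end BrouckeVindas

end Literature.NumberTheory.BeurlingPrimes
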